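import Mathlib.Analysis.SpecialFunctions.Pow.Real
import Literature.RepresentationTheory.FiniteGroups.IrreducibleCharacters

/-!
# Stub `stub_shareUniversality` of `LevelGradedCohnUmans.GradedDesignFamily` — explicit, elementary route

An independent, self-contained proof of the registered stub `stub_shareUniversality` of the crux
`GradedDesignFamily` (stmt-MatrixMultiplication-7610), written with an EXPLICIT ratio and only
elementary real-power bookkeeping.

**Statement.**  A fixed filling fraction `c > 0` and, for every ratio `R`, a finite host `G`
with a bi-invariant test space `J ≤ ℂ^G`, wall `B₂ = Σ_{χ ∈ Irr G ∩ J} χ(1)² > 0`, `t ≥ 1`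
simultaneously `J`-separated pieces `(X_i, Y_i, Z_i)` each of volume `≥ c (B₂/t)^{3/2}`, and
`R t χ(1)² ≤ B₂` for every visible irreducible `χ`, give for every `ε > 0` a graded simultaneous
family at exponent `2 + ε`:  `Σ_{χ ∈ Irr G ∩ J} χ(1)^{2+ε} < Σ_i (|X_i| |Y_i| |Z_i|)^{(2+ε)/3}`.

**Proof (explicit).**  Put `K := c^{(2+ε)/3}` and take the family at the explicit ratio
`R := (2/K)^{2/ε}`, for which `R^{ε/2} · K = 2`.  Write `s := B₂/t` for the share of one
piece.  Every visible degree `d = χ(1) ∈ ℕ` has `d² ≤ s/R`, hence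
`d^{2+ε} = d² · (d²)^{ε/2} ≤ d² · (s/R)^{ε/2}`; summing, the graded budget is at most
`B₂ · (s/R)^{ε/2}`.  Every piece has volume `V_i ≥ c s^{3/2}`, hence
`V_i^{(2+ε)/3} ≥ K · s · s^{ε/2}`; summing over the `t` pieces and using `t s = B₂`, the value
is at least `K · B₂ · s^{ε/2} = B₂ (s/R)^{ε/2} · (R^{ε/2} K) = 2 · B₂ (s/R)^{ε/2}`, twice the
budget bound, which is positive.  [cite: CohnKleinbergSzegedyUmans2005, Thm. 5.5]

Only `irrChars_finite_holds` (finitely many irreducible characters) and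
`IsIrrChar.exists_apply_one` (`χ(1) ∈ ℕ`) are used from the character library.
-/

noncomputable section

set_option linter.dupNamespace false

open scoped BigOperators
open Literature.RepresentationTheory.FiniteGroups

namespace Summit.MatrixMultiplication.MatrixMultiplication.Theorems.GradedDesignFamily.ShareUniversalityExplicit

/-- The value at `1` of an irreducible character is (the cast of) a natural number. [folklore] -/
theorem exists_re_apply_one_eq_natCast {G : Type} [Group G] {χ : G → ℂ} (h : IsIrrChar G χ) :
    ∃ d : ℕ, (χ 1).re = d := by
  obtain ⟨d, -, hd⟩ := h.exists_apply_one
  exact ⟨d, by rw [hd, Complex.natCast_re]⟩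

/-- Termwise budget bound: `0 ≤ d`, `d² ≤ M`, `0 < e` give `d^{2+e} ≤ d² · M^{e/2}`
(because `d^{2+e} = d² · (d²)^{e/2}`). [folklore] -/
theorem rpow_two_add_le {d M e : ℝ} (hd : 0 ≤ d) (hM : d ^ 2 ≤ M) (he : 0 < e) :
    d ^ (2 + e) ≤ d ^ 2 * M ^ (e / 2) := by
  have h2 : (0 : ℝ) ≤ d ^ 2 := sq_nonneg d
  rw [Real.rpow_add' hd (by linarith : (0 : ℝ) < 2 + e).ne', Real.rpow_two]
  refine mul_le_mul_of_nonneg_left ?_ h2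
  calc d ^ e = (d ^ 2) ^ (e / 2) := by
        rw [← Real.rpow_two, ← Real.rpow_mul hd]
        congr 1
        ring
    _ ≤ M ^ (e / 2) := Real.rpow_le_rpow h2 hM (by linarith)

/-- Termwise value bound: `0 ≤ c`, `0 ≤ s`, `0 < e` and `c · s^{3/2} ≤ V` give
`c^{(2+e)/3} · (s · s^{e/2}) ≤ V^{(2+e)/3}` (raise to the power `(2+e)/3` and use
`(s^{3/2})^{(2+e)/3} = s^{1 + e/2}`). [folklore] -/
theorem rpow_value_le {c s V e : ℝ} (hc : 0 ≤ c) (hs : 0 ≤ s) (he : 0 < e)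
    (hV : c * s ^ (3 / 2 : ℝ) ≤ V) :
    c ^ ((2 + e) / 3) * (s * s ^ (e / 2)) ≤ V ^ ((2 + e) / 3) := by
  have h0 : 0 ≤ c * s ^ (3 / 2 : ℝ) := mul_nonneg hc (Real.rpow_nonneg hs _)
  have key : (c * s ^ (3 / 2 : ℝ)) ^ ((2 + e) / 3) = c ^ ((2 + e) / 3) * (s * s ^ (e / 2)) := by
    rw [Real.mul_rpow hc (Real.rpow_nonneg hs _), ← Real.rpow_mul hs,
      show (3 / 2 : ℝ) * ((2 + e) / 3) = 1 + e / 2 by ring,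
      Real.rpow_add' hs (by linarith : (0 : ℝ) < 1 + e / 2).ne', Real.rpow_one]
  rw [← key]
  exact Real.rpow_le_rpow h0 hV (by linarith)

/-- **The elementary inequality behind `stub_shareUniversality`.**  A finite index set `S`
with nonnegative "degrees" `d`, the wall `B = Σ_{χ ∈ S} (d χ)² > 0`, `t ≥ 1` "volumes"
`V i ≥ c (B/t)^{3/2}` (`c > 0`), a ratio `R > 0` with `R t (d χ)² ≤ B` on `S`, and the gain
condition `1 < R^{ε/2} · c^{(2+ε)/3}` (`ε > 0`) force
`Σ_{χ ∈ S} (d χ)^{2+ε} < Σ_i (V i)^{(2+ε)/3}`:  with `s = B/t`, the left side is at most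
`B (s/R)^{ε/2}` and the right side is at least `c^{(2+ε)/3} B s^{ε/2}`.
[cite: CohnKleinbergSzegedyUmans2005, Thm. 5.5] -/
theorem sum_rpow_lt_sum_rpow {α : Type*} (S : Finset α) (d : α → ℝ) (t : ℕ) (V : Fin t → ℝ)
    (c R B ε : ℝ) (hc : 0 < c) (hε : 0 < ε) (hR : 0 < R)
    (hgain : 1 < R ^ (ε / 2) * c ^ ((2 + ε) / 3)) (ht : 1 ≤ t)
    (hB : B = ∑ χ ∈ S, d χ ^ 2) (hB0 : 0 < B) (hd : ∀ χ ∈ S, 0 ≤ d χ)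
    (hdeg : ∀ χ ∈ S, R * t * d χ ^ 2 ≤ B)
    (hvol : ∀ i : Fin t, c * (B / t) ^ (3 / 2 : ℝ) ≤ V i) :
    ∑ χ ∈ S, d χ ^ (2 + ε) < ∑ i : Fin t, V i ^ ((2 + ε) / 3) := by
  have htpos : (0 : ℝ) < t := by exact_mod_cast ht
  set s : ℝ := B / t with hs
  have hspos : 0 < s := div_pos hB0 htpos
  have htB : (t : ℝ) * s = B := by
    rw [hs]
    field_simp
  -- the share bound on the degrees: `d² ≤ s / R`
  have hdeg' : ∀ χ ∈ S, d χ ^ 2 ≤ s / R := by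
    intro χ hχ
    rw [le_div_iff₀ hR, hs, le_div_iff₀ htpos]
    calc d χ ^ 2 * R * t = R * t * d χ ^ 2 := by ring
      _ ≤ B := hdeg χ hχ
  -- (1) the graded budget is at most `B (s/R)^{ε/2}`
  have hbud : ∑ χ ∈ S, d χ ^ (2 + ε) ≤ B * (s / R) ^ (ε / 2) := by
    calc ∑ χ ∈ S, d χ ^ (2 + ε) ≤ ∑ χ ∈ S, d χ ^ 2 * (s / R) ^ (ε / 2) :=
          Finset.sum_le_sum fun χ hχ => rpow_two_add_le (hd χ hχ) (hdeg' χ hχ) hε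
      _ = B * (s / R) ^ (ε / 2) := by rw [← Finset.sum_mul, ← hB]
  -- (2) the value is at least `t · c^{(2+ε)/3} · s · s^{ε/2}`
  have hval : (t : ℝ) * (c ^ ((2 + ε) / 3) * (s * s ^ (ε / 2))) ≤
      ∑ i : Fin t, V i ^ ((2 + ε) / 3) := by
    calc (t : ℝ) * (c ^ ((2 + ε) / 3) * (s * s ^ (ε / 2)))
          = ∑ _i : Fin t, c ^ ((2 + ε) / 3) * (s * s ^ (ε / 2)) := by
          rw [Finset.sum_const, Finset.card_univ, Fintype.card_fin, nsmul_eq_mul]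
      _ ≤ ∑ i : Fin t, V i ^ ((2 + ε) / 3) :=
          Finset.sum_le_sum fun i _ => rpow_value_le hc.le hspos.le hε (hvol i)
  -- (3) comparison through the gain `R^{ε/2} c^{(2+ε)/3} > 1`
  have hsR : (s / R) ^ (ε / 2) * R ^ (ε / 2) = s ^ (ε / 2) := by
    rw [← Real.mul_rpow (div_nonneg hspos.le hR.le) hR.le, div_mul_cancel₀ _ hR.ne']
  have hpos : 0 < B * (s / R) ^ (ε / 2) := mul_pos hB0 (Real.rpow_pos_of_pos (div_pos hspos hR) _)
  calc ∑ χ ∈ S, d χ ^ (2 + ε) ≤ B * (s / R) ^ (ε / 2) := hbud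
    _ = B * (s / R) ^ (ε / 2) * 1 := (mul_one _).symm
    _ < B * (s / R) ^ (ε / 2) * (R ^ (ε / 2) * c ^ ((2 + ε) / 3)) :=
        mul_lt_mul_of_pos_left hgain hpos
    _ = (t : ℝ) * (c ^ ((2 + ε) / 3) * (s * s ^ (ε / 2))) := by
        rw [← htB, ← hsR]
        ring
    _ ≤ ∑ i : Fin t, V i ^ ((2 + ε) / 3) := hval

/-- **stub_shareUniversality — splitting the wall among `t` pieces is free** (explicit route).
Shared-wall families (a fixed filling fraction `c > 0`; for every ratio `R` a finite host with a
bi-invariant `J`, `t ≥ 1` simultaneously `J`-separated pieces each of volume `≥ c (B₂/t)^{3/2}`,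
`B₂ = Σ_{Irr ∩ J} χ(1)² > 0`, and `R t χ(1)² ≤ B₂` for every visible irreducible) give a graded
simultaneous family at every exponent `2 + ε`, `ε > 0`: take the family at the explicit ratio
`R = (2 / c^{(2+ε)/3})^{2/ε}` and apply `sum_rpow_lt_sum_rpow`.
[cite: CohnKleinbergSzegedyUmans2005, Thm. 5.5] -/
theorem stub_shareUniversality (c : ℝ) (hc : 0 < c)
    (hfam : ∀ R : ℝ, ∃ (G : Type) (_ : Group G) (_ : Fintype G) (J : Submodule ℂ (G → ℂ))
      (B₂ : ℝ) (t : ℕ) (X Y Z : Fin t → Finset G),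
      B₂ = (∑ᶠ χ ∈ Literature.RepresentationTheory.FiniteGroups.irrChars G ∩ (J : Set (G → ℂ)),
        (χ 1).re ^ (2 : ℝ)) ∧
      (∀ f ∈ J, ∀ a b : G, (fun g : G => f (a * g * b)) ∈ J) ∧
      (∀ i : Fin t, ∀ x₀ ∈ X i, ∀ z₀ ∈ Z i, ∃ f ∈ J, ∀ j k : Fin t,
        ∀ x ∈ X j, ∀ y ∈ Y j, ∀ y' ∈ Y k, ∀ z ∈ Z k,
          ((j = i ∧ k = i ∧ x = x₀ ∧ y = y' ∧ z = z₀) → f (x⁻¹ * y * y'⁻¹ * z) = 1) ∧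
          (¬ (j = i ∧ k = i ∧ x = x₀ ∧ y = y' ∧ z = z₀) → f (x⁻¹ * y * y'⁻¹ * z) = 0)) ∧
      1 ≤ t ∧ 0 < B₂ ∧
      (∀ i, c * (B₂ / t) ^ (3 / 2 : ℝ) ≤ ((((X i).card * (Y i).card * (Z i).card : ℕ) : ℝ))) ∧
      (∀ χ ∈ Literature.RepresentationTheory.FiniteGroups.irrChars G ∩ (J : Set (G → ℂ)),
        R * t * (χ 1).re ^ 2 ≤ B₂))
    (ε : ℝ) (hε : 0 < ε) :
    ∃ (H : Type) (_ : Group H) (_ : Fintype H) (J : Submodule ℂ (H → ℂ)) (n : ℕ)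
      (X Y Z : Fin n → Finset H),
      (∀ f ∈ J, ∀ a b : H, (fun g : H => f (a * g * b)) ∈ J) ∧
      (∀ i : Fin n, ∀ x₀ ∈ X i, ∀ z₀ ∈ Z i, ∃ f ∈ J, ∀ j k : Fin n,
        ∀ x ∈ X j, ∀ y ∈ Y j, ∀ y' ∈ Y k, ∀ z ∈ Z k,
          ((j = i ∧ k = i ∧ x = x₀ ∧ y = y' ∧ z = z₀) → f (x⁻¹ * y * y'⁻¹ * z) = 1) ∧
          (¬ (j = i ∧ k = i ∧ x = x₀ ∧ y = y' ∧ z = z₀) → f (x⁻¹ * y * y'⁻¹ * z) = 0)) ∧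
      (∑ᶠ χ ∈ Literature.RepresentationTheory.FiniteGroups.irrChars H ∩ (J : Set (H → ℂ)),
        (χ 1).re ^ (2 + ε)) <
        ∑ i, ((((X i).card * (Y i).card * (Z i).card : ℕ) : ℝ) ^ ((2 + ε) / 3)) := by
  -- the explicit ratio `R := (2 / K) ^ (2 / ε)`, `K := c ^ ((2 + ε) / 3)`, with `R ^ (ε/2) · K = 2`
  have hKpos : 0 < c ^ ((2 + ε) / 3) := Real.rpow_pos_of_pos hc _
  have h2K : 0 < 2 / c ^ ((2 + ε) / 3) := div_pos two_pos hKpos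
  have hRpos : 0 < (2 / c ^ ((2 + ε) / 3)) ^ (2 / ε) := Real.rpow_pos_of_pos h2K _
  have hgain : 1 < ((2 / c ^ ((2 + ε) / 3)) ^ (2 / ε)) ^ (ε / 2) * c ^ ((2 + ε) / 3) := by
    rw [← Real.rpow_mul h2K.le, show 2 / ε * (ε / 2) = 1 by field_simp, Real.rpow_one,
      div_mul_cancel₀ _ hKpos.ne']
    exact one_lt_two
  obtain ⟨G, _instG, _instF, J, B₂, t, X, Y, Z, hB, hJ, hsep, ht, hB0, hvol, hdeg⟩ :=
    hfam ((2 / c ^ ((2 + ε) / 3)) ^ (2 / ε))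
  refine ⟨G, inferInstance, inferInstance, J, t, X, Y, Z, hJ, hsep, ?_⟩
  have hfin : (irrChars G ∩ (J : Set (G → ℂ))).Finite :=
    (irrChars_finite_holds G).subset Set.inter_subset_left
  rw [finsum_mem_eq_finite_toFinset_sum _ hfin] at hB
  rw [finsum_mem_eq_finite_toFinset_sum _ hfin]
  have hB' : B₂ = ∑ χ ∈ hfin.toFinset, (χ 1).re ^ 2 := by
    rw [hB]
    exact Finset.sum_congr rfl fun χ _ => Real.rpow_two _
  have hd : ∀ χ ∈ hfin.toFinset, 0 ≤ (χ 1).re := fun χ hχ => by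
    obtain ⟨d, hd⟩ := exists_re_apply_one_eq_natCast (hfin.mem_toFinset.mp hχ).1
    rw [hd]
    exact Nat.cast_nonneg d
  exact sum_rpow_lt_sum_rpow hfin.toFinset (fun χ => (χ 1).re) t
    (fun i => (((X i).card * (Y i).card * (Z i).card : ℕ) : ℝ)) c _ B₂ ε hc hε hRpos hgain ht hB'
    hB0 hd (fun χ hχ => hdeg χ (hfin.mem_toFinset.mp hχ)) hvol

end Summit.MatrixMultiplication.MatrixMultiplication.Theorems.GradedDesignFamily.ShareUniversalityExplicit

end
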